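import Mathlib
import Summits.NavierStokesRegularity.NavierStokesRegularity.Theorems.EulerZoomLiouvillePowerGaugeEulerLiouvilleMomentFloorLaw
import Summits.NavierStokesRegularity.NavierStokesRegularity.Theorems.EulerZoomLiouvillePowerGaugeEulerLiouvilleTwoSidedMomentLaw
import Summits.NavierStokesRegularity.NavierStokesRegularity.Theorems.EulerZoomLiouvillePowerGaugeEulerLiouvilleNeedleSupportDensityFloor
import Summits.NavierStokesRegularity.NavierStokesRegularity.Theorems.EulerZoomLiouvillePowerGaugeEulerLiouvilleSmallMomentLaw
import HarnessLib

/-!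
# VORTICAL STRAIN DEPLETION: on large balls the `‖Ω‖^q`-weighted mean of `‖DV‖` decays like `R^{−(1+ρ/2)}`
# (a portrait corollary of THE FLOOR (nsreg-p2 ROUND-53) and R52 §E's small-moment law = the EULERIAN form of SEEDS-R54 S3 (c2) «integrable strain in mean»;
# seat ns-ezl-w3 g8, `--supports stmt-NavierStokesRegularity-19832 --as helper`)

For a `C²` self-similar Euler profile `(V, P)` (`γ = 1/(2+ρ)`, centre `0`, `0 < ρ < 1`) of the budget class (finite weighted energy `E_w`, `A`-gauge) with
`Ω = curl V ≢ 0`, and every `q ∈ (0, ½)`: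
`∫_{B_R} ‖Ω‖^q‖DV‖ ≤ C·R^{−(1+ρ/2)}·∫_{B_R} ‖Ω‖^q` for all `R ≥ R₁` —
i.e. the mean of the velocity gradient with respect to the probability measure `‖Ω‖^q dy / ∫_{B_R}‖Ω‖^q` decays like `R^{−(1+ρ/2)} = e^{−γ(1+ρ/2)s}` at the similarity
scale `R = e^{γs}`: «where the vorticity is (in `q`-mean), the gradient is small» — the vortical mass AVOIDS the needle's fast cores (where `‖DV‖ ≳ R^{2+ρ}`).  The rate is
exactly the integrand of SEEDS-R54 S3 (c2) («integrable strain in mean», heuristic `≲ e^{−γ(1+ρ/2)s}`), `q`-independent; it is still `≫` the borderline `R^{−(2+ρ)}`, so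
no contradiction is claimed.
Proof: Cauchy–Schwarz on `B_R`, the `2q`-moment by sfl-p1's `SmallMoment.smallMomentLaw` (`2q < 1`), `∫_{B_R}‖DV‖² ≤ R^{1−ρ}E_w`
(`SmallMoment.setIntegral_norm_fderiv_sq_le_of_weightedEnergy`), divided by THE FLOOR at order `q`
(`MomentFloor.momentFloorLaw_of_twoSided_of_supportFloor` ∘ `TwoSidedMoment.twoSidedMomentLaw` ∘ `Floor.supportDensityFloor`, all BY NAME).

* `MomentFloor.setIntegral_rpow_mul_norm_le_sqrt` — the Cauchy–Schwarz step on a ball;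
* ★ `MomentFloor.vorticalStrainDepletion` — the statement above.

HONEST FRAMING: a portrait statement about HYPOTHETICAL nontrivial profiles (instrument-level); nothing about the crux E (`PowerGaugeEulerLiouville`, stmt 19832, OPEN) or NS regularity
is proved; MODEL-lattice crux class; not E. [nsreg-p2 R53 §5 / SEEDS-R54 S3 (c2); folklore]
-/

noncomputable section

set_option linter.dupNamespace false

open MeasureTheory Set Filter Topology Metric Function TopologicalSpace
open scoped ENNReal NNReal RealInnerProductSpace Topology

namespace Summit.NavierStokesRegularity.NavierStokesRegularity.Theorems.PowerGaugeEulerLiouville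

open Literature.Analysis Literature.Analysis.FunctionSpaces Literature.Analysis.FluidPDE

namespace MomentFloor

variable {ρ : ℝ} {V : EuclideanSpace ℝ (Fin 3) → EuclideanSpace ℝ (Fin 3)}

/-- **Cauchy–Schwarz on a ball**: for continuous `Ω`, `G` and `q > 0`, `∫_{B_R}‖Ω‖^q‖G‖ ≤ (∫_{B_R}‖Ω‖^{2q})^{1/2}·(∫_{B_R}‖G‖²)^{1/2}`. [folklore] -/
theorem setIntegral_rpow_mul_norm_le_sqrt {F : Type*} [NormedAddCommGroup F]
    {Ω : EuclideanSpace ℝ (Fin 3) → EuclideanSpace ℝ (Fin 3)} {G : EuclideanSpace ℝ (Fin 3) → F}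
    (hΩ : Continuous Ω) (hG : Continuous G) {q : ℝ} (hq : 0 < q) (R : ℝ) :
    ∫ y in ball (0 : EuclideanSpace ℝ (Fin 3)) R, ‖Ω y‖ ^ q * ‖G y‖ ≤
      (∫ y in ball (0 : EuclideanSpace ℝ (Fin 3)) R, ‖Ω y‖ ^ (2 * q)) ^ (1 / 2 : ℝ) *
        (∫ y in ball (0 : EuclideanSpace ℝ (Fin 3)) R, ‖G y‖ ^ 2) ^ (1 / 2 : ℝ) := by
  set μ : Measure (EuclideanSpace ℝ (Fin 3)) := volume.restrict (ball (0 : EuclideanSpace ℝ (Fin 3)) R) with hμ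
  have hf : Continuous fun y => ‖Ω y‖ ^ q := hΩ.norm.rpow_const fun _ => Or.inr hq.le
  have hfm : MemLp (fun y => ‖Ω y‖ ^ q) (ENNReal.ofReal 2) μ := by
    rw [show ENNReal.ofReal 2 = (2 : ℝ≥0∞) by norm_num]
    exact NeedleDigest.memLp_ball_of_continuous hf R 2
  have hgm : MemLp (fun y => ‖G y‖) (ENNReal.ofReal 2) μ := by
    rw [show ENNReal.ofReal 2 = (2 : ℝ≥0∞) by norm_num]
    exact NeedleDigest.memLp_ball_of_continuous hG.norm R 2
  have h := integral_mul_le_Lp_mul_Lq_of_nonneg (μ := μ) Real.HolderConjugate.two_two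
    (Eventually.of_forall fun y => Real.rpow_nonneg (norm_nonneg _) q) (Eventually.of_forall fun y => norm_nonneg _) hfm hgm
  have e1 : ∀ y, (‖Ω y‖ ^ q) ^ (2 : ℝ) = ‖Ω y‖ ^ (2 * q) := fun y => by
    rw [← Real.rpow_mul (norm_nonneg _)]; ring_nf
  have e2 : ∀ y, ‖G y‖ ^ (2 : ℝ) = ‖G y‖ ^ (2 : ℕ) := fun y => Real.rpow_two _
  simp_rw [e1, e2] at h
  exact h

/-- ★ **VORTICAL STRAIN DEPLETION** (`0 < ρ < 1`): for a `C²` self-similar Euler profile of the budget class with `curl V ≢ 0` and every `q ∈ (0,½)` there are `C, R₁`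
with `∫_{B_R}‖curl V‖^q·‖DV‖ ≤ C·R^{−(1+ρ/2)}·∫_{B_R}‖curl V‖^q` for all `R ≥ R₁` — the vorticity-weighted mean strain decays at the rate `R^{−(1+ρ/2)}`
(the Eulerian form of SEEDS-R54 S3 (c2): `e^{−γ(1+ρ/2)s}` at `R = e^{γs}`). Proof: Cauchy–Schwarz, the `2q`-moment by `SmallMoment.smallMomentLaw`, the local energy by
the weighted energy, and THE FLOOR at order `q`. [nsreg-p2 R53 §5 / SEEDS-R54 S3 (c2); folklore] -/
theorem vorticalStrainDepletion (hρ : 0 < ρ) (hρ1 : ρ < 1) :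
    ∀ P : EuclideanSpace ℝ (Fin 3) → ℝ, IsSelfSimilarEulerProfile (1 / (2 + ρ)) 0 V P →
      (∫⁻ y, ‖fderiv ℝ V y‖ₑ ^ 2 * ENNReal.ofReal (‖y‖ ^ (ρ - 1))) ≠ ⊤ →
      (∃ A : ℝ, ∀ R : ℝ, 1 ≤ R → ∫ y in Metric.ball (0 : EuclideanSpace ℝ (Fin 3)) R, ‖V y‖ ^ 2 ≤ A * R ^ (1 - 2 * ρ)) →
      (∃ y, curl V y ≠ 0) →
        ∀ q : ℝ, 0 < q → q < 1 / 2 → ∃ C R₁ : ℝ, ∀ R : ℝ, R₁ ≤ R →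
          ∫ y in Metric.ball (0 : EuclideanSpace ℝ (Fin 3)) R, ‖curl V y‖ ^ q * ‖fderiv ℝ V y‖ ≤
            C * R ^ (-(1 + ρ / 2)) * ∫ y in Metric.ball (0 : EuclideanSpace ℝ (Fin 3)) R, ‖curl V y‖ ^ q := by
  intro P hprof hE hA hne q hq hq12
  have hV2 : ContDiff ℝ 2 V := hprof.contDiff_velocity
  have hΩc : Continuous (curl V) := (contDiff_curl (n := 1) (by exact_mod_cast hV2)).continuous
  have hDVc : Continuous (fderiv ℝ V) := hV2.continuous_fderiv (by norm_num)
  -- THE FLOOR at order `q`, the `2q`-moment upper law, the local energy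
  have hfloor : MomentFloorLaw ρ V :=
    momentFloorLaw_of_twoSided_of_supportFloor hρ (TwoSidedMoment.twoSidedMomentLaw hρ hρ1 V) (Floor.supportDensityFloor hρ)
  obtain ⟨ℓ, R₁, hℓ, hfl⟩ := hfloor P hprof hE hA hne q hq (by linarith)
  obtain ⟨C₁, hC₁⟩ := SmallMoment.smallMomentLaw hρ hρ1 V P hprof q hq hq12 hE hA
  set Ew : ℝ := (∫⁻ y, ‖fderiv ℝ V y‖ₑ ^ 2 * ENNReal.ofReal (‖y‖ ^ (ρ - 1))).toReal with hEw
  have hEw0 : 0 ≤ Ew := ENNReal.toReal_nonneg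
  -- `C₁ ≥ 0` (from the law at `R = 1`)
  have hC₁0 : 0 ≤ C₁ := by
    have h := hC₁ 1 le_rfl
    rw [Real.one_rpow, mul_one] at h
    exact (integral_nonneg fun y => Real.rpow_nonneg (norm_nonneg _) _).trans h
  set K : ℝ := C₁ ^ (1 / 2 : ℝ) * Ew ^ (1 / 2 : ℝ) with hKdef
  have hK0 : 0 ≤ K := by positivity
  refine ⟨K / ℓ, max R₁ 1, fun R hR => ?_⟩
  have hR1 : 1 ≤ R := le_trans (le_max_right _ _) hR
  have hRR₁ : R₁ ≤ R := le_trans (le_max_left _ _) hR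
  have hR0 : 0 < R := by linarith
  -- Cauchy–Schwarz and the two budget bounds
  have hCS := setIntegral_rpow_mul_norm_le_sqrt hΩc hDVc hq R
  have hM2 : ∫ y in ball (0 : EuclideanSpace ℝ (Fin 3)) R, ‖curl V y‖ ^ (2 * q) ≤ C₁ * R ^ (3 - 2 * q * (2 + ρ)) := hC₁ R hR1
  have hEn : ∫ y in ball (0 : EuclideanSpace ℝ (Fin 3)) R, ‖fderiv ℝ V y‖ ^ 2 ≤ R ^ (1 - ρ) * Ew :=
    SmallMoment.setIntegral_norm_fderiv_sq_le_of_weightedEnergy hρ1 hE hR0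
  have hM20 : 0 ≤ ∫ y in ball (0 : EuclideanSpace ℝ (Fin 3)) R, ‖curl V y‖ ^ (2 * q) :=
    integral_nonneg fun y => Real.rpow_nonneg (norm_nonneg _) _
  have hEn0 : 0 ≤ ∫ y in ball (0 : EuclideanSpace ℝ (Fin 3)) R, ‖fderiv ℝ V y‖ ^ 2 := integral_nonneg fun y => sq_nonneg _
  have h1 : ∫ y in ball (0 : EuclideanSpace ℝ (Fin 3)) R, ‖curl V y‖ ^ q * ‖fderiv ℝ V y‖ ≤
      (C₁ * R ^ (3 - 2 * q * (2 + ρ))) ^ (1 / 2 : ℝ) * (R ^ (1 - ρ) * Ew) ^ (1 / 2 : ℝ) :=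
    hCS.trans (mul_le_mul (Real.rpow_le_rpow hM20 hM2 (by norm_num)) (Real.rpow_le_rpow hEn0 hEn (by norm_num))
      (Real.rpow_nonneg hEn0 _) (Real.rpow_nonneg (by positivity) _))
  -- `= K · R^{2 − q(2+ρ) − ρ/2}`
  have h2 : (C₁ * R ^ (3 - 2 * q * (2 + ρ))) ^ (1 / 2 : ℝ) * (R ^ (1 - ρ) * Ew) ^ (1 / 2 : ℝ) =
      K * R ^ (2 - q * (2 + ρ) - ρ / 2) := by
    rw [Real.mul_rpow hC₁0 (Real.rpow_nonneg hR0.le _), Real.mul_rpow (Real.rpow_nonneg hR0.le _) hEw0,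
      ← Real.rpow_mul hR0.le, ← Real.rpow_mul hR0.le]
    have e : R ^ ((3 - 2 * q * (2 + ρ)) * (1 / 2)) * R ^ ((1 - ρ) * (1 / 2)) = R ^ (2 - q * (2 + ρ) - ρ / 2) := by
      rw [← Real.rpow_add hR0]; congr 1; ring
    calc C₁ ^ (1 / 2 : ℝ) * R ^ ((3 - 2 * q * (2 + ρ)) * (1 / 2)) * (R ^ ((1 - ρ) * (1 / 2)) * Ew ^ (1 / 2 : ℝ))
        = C₁ ^ (1 / 2 : ℝ) * Ew ^ (1 / 2 : ℝ) * (R ^ ((3 - 2 * q * (2 + ρ)) * (1 / 2)) * R ^ ((1 - ρ) * (1 / 2))) := by ring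
      _ = K * R ^ (2 - q * (2 + ρ) - ρ / 2) := by rw [e]
  -- THE FLOOR: `ℓ R^{3 − q(2+ρ)} ≤ ∫_{B_R}‖Ω‖^q`, and `R^{2−q(2+ρ)−ρ/2} = R^{−(1+ρ/2)}·R^{3−q(2+ρ)}`
  have hflR := hfl R hRR₁
  have e3 : R ^ (2 - q * (2 + ρ) - ρ / 2) = R ^ (-(1 + ρ / 2)) * R ^ (3 - q * (2 + ρ)) := by
    rw [← Real.rpow_add hR0]; congr 1; ring
  calc ∫ y in ball (0 : EuclideanSpace ℝ (Fin 3)) R, ‖curl V y‖ ^ q * ‖fderiv ℝ V y‖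
      ≤ K * R ^ (2 - q * (2 + ρ) - ρ / 2) := h1.trans h2.le
    _ = K / ℓ * R ^ (-(1 + ρ / 2)) * (ℓ * R ^ (3 - q * (2 + ρ))) := by rw [e3]; field_simp
    _ ≤ K / ℓ * R ^ (-(1 + ρ / 2)) * ∫ y in ball (0 : EuclideanSpace ℝ (Fin 3)) R, ‖curl V y‖ ^ q :=
        mul_le_mul_of_nonneg_left hflR (mul_nonneg (div_nonneg hK0 hℓ.le) (Real.rpow_nonneg hR0.le _))

end MomentFloor

end Summit.NavierStokesRegularity.NavierStokesRegularity.Theorems.PowerGaugeEulerLiouville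

end
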